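import Literature.AlgebraicGeometry.Resolution.ArithmeticalThreefolds
import Mathlib.RingTheory.Localization.AsSubring
import Mathlib.RingTheory.Localization.LocalizationLocalization
import Mathlib.Algebra.Polynomial.Eval.Coeff
import HarnessLib

/-!
# (LU) for the local rings of affine models from relative local uniformization

Topic: `Literature/AlgebraicGeometry/Resolution`. PROVED bridge announced in the module
docstring of `ArithmeticalThreefolds.lean` ("Faithfulness notes", first item): relative local
uniformization of affine models of dimension `≤ 3` over a field `k` (`LocalUniformization3 k`)
implies Cossart–Piltant's property (LU) (`CPLocalUniformization`, CP 2019 §4.1) for every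
local ring `A_𝔭` of every affine model `A` (finitely generated `k`-domain) of dimension `≤ 3` —
in fact for ALL dominating valuations, not only those with algebraic residue extension.

## Content

* `valuation_comap_lt_one_iff` — pulling back a valuation ring along a field homomorphism
  preserves "valuation `< 1`".
* `cpLocalUniformization_of_fractionField` — to establish `CPLocalUniformization A` it suffices
  to uniformize the dominating valuation rings of ONE fraction field `K` of `A` (transport
  along the `A`-isomorphism `K' ≃ K` of fraction fields).
* `isRegularLocalRing_localization_of_sandwich` — if `A' ⊆ T ⊆ K` are subrings of a field,
  `P ⊆ T` a prime with `P ∩ A' = P'`, and every element of `T` is `a'/s'` with `a' ∈ A'`,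
  `s' ∈ A' ∖ P'`, then `T_P ≅ A'_{P'}`; so `T_P` is regular if `A'_{P'}` is.
* `LocalUniformization3.cpLocalUniformization` — the bridge:
  `LocalUniformization3 k →` for every finitely generated `k`-subalgebra `A` of a field `K`
  with `Frac A = K`, `dim A ≤ 3`, and every prime `𝔭` of `A`,
  `CPLocalUniformization (Localization.AtPrime 𝔭)`.
* `CossartPiltant2019LU3.cpLocalUniformization` — the same under the named fact.

## The argument (CP 2019 §4.1, module docstring of `ArithmeticalThreefolds.lean`)

Given a valuation ring `𝒪_v` of `K = Frac A_𝔭 = Frac A` containing `A_𝔭` and dominating it, it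
contains `A`; `LocalUniformization3` gives `A ⊆ A' ⊆ 𝒪_v` finitely generated over `k`, say
`A' = k[t]`, with `A'_{P'}` regular, `P' = 𝔪_v ∩ A'`. Put `T := A_𝔭[t] ⊆ 𝒪_v`, a finitely
generated `A_𝔭`-algebra containing `A'`. Elements of `A ∖ 𝔭` are units of `A_𝔭 ⊆ 𝒪_v`, so lie
outside `P'`; hence every element of `T` has the form `a'/s'`, `a' ∈ A'`, `s' ∈ A' ∖ P'`, and
`T_{𝔪_v ∩ T} = A'_{P'}` inside `K`.

[cite: CossartPiltant2019, §4.1 (LU)]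
-/

noncomputable section

open IsLocalRing

namespace Literature.AlgebraicGeometry.Resolution

universe u

/-! ## Valuation rings pulled back along field isomorphisms -/

/-- Pulling back a valuation subring along a field homomorphism preserves "`v < 1`".
[folklore] -/
theorem valuation_comap_lt_one_iff {K L : Type u} [Field K] [Field L] (O : ValuationSubring L)
    (f : K →+* L) (x : K) :
    (O.comap f).valuation x < 1 ↔ O.valuation (f x) < 1 := by
  rw [← ValuationSubring.mem_nonunits_iff, ← ValuationSubring.mem_nonunits_iff,
    ValuationSubring.mem_nonunits_iff_or, ValuationSubring.mem_nonunits_iff_or,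
    ValuationSubring.mem_comap, map_inv₀, map_eq_zero_iff f f.injective]

/-- **Transport.** To prove Cossart–Piltant's (LU) for a local domain `A` it suffices to
uniformize, inside ONE fraction field `K` of `A`, every valuation ring of `K` containing `A`
and dominating it (no restriction on the residue extension): any other fraction field `K'` is
`A`-isomorphic to `K`, and valuation rings, finitely generated subalgebras, centres and their
localisations are transported along the isomorphism. [folklore] -/
theorem cpLocalUniformization_of_fractionField (A : Type u) [CommRing A] [IsDomain A]
    [IsLocalRing A] (K : Type u) [Field K] [Algebra A K] [IsFractionRing A K]
    (h : ∀ O : ValuationSubring K, (∀ a : A, algebraMap A K a ∈ O) →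
      (∀ a ∈ maximalIdeal A, O.valuation (algebraMap A K a) < 1) →
        ∃ (s : Finset K) (hs : (Algebra.adjoin A (s : Set K)).toSubring ≤ O.toSubring),
          IsRegularLocalRing (Localization.AtPrime
            (Ideal.comap (Subring.inclusion hs) (maximalIdeal O)))) :
    CPLocalUniformization A := by
  classical
  intro K' _ _ _ O hAO hdom _
  -- the `A`-isomorphism of fraction fields
  let e : K' ≃ₐ[A] K := IsLocalization.algEquiv (nonZeroDivisors A) K' K
  let f : K →+* K' := (e.symm : K ≃ₐ[A] K').toRingEquiv.toRingHom
  have hf : ∀ x, f x = e.symm x := fun _ => rfl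
  let OK : ValuationSubring K := O.comap f
  have hAOK : ∀ a : A, algebraMap A K a ∈ OK := fun a => by
    show f (algebraMap A K a) ∈ O
    rw [hf, AlgEquiv.commutes]
    exact hAO a
  have hdomK : ∀ a ∈ maximalIdeal A, OK.valuation (algebraMap A K a) < 1 := fun a ha => by
    rw [valuation_comap_lt_one_iff, hf, AlgEquiv.commutes]
    exact hdom a ha
  obtain ⟨s, hs, hreg⟩ := h OK hAOK hdomK
  -- transport the uniformizing algebra back to `K'`
  let T : Subalgebra A K := Algebra.adjoin A (s : Set K)
  let T' : Subalgebra A K' := Algebra.adjoin A ((s.image e.symm : Finset K') : Set K')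
  have hT' : T' = T.map (e.symm : K →ₐ[A] K') := by
    simp only [T', T, Finset.coe_image, AlgHom.map_adjoin]
    rfl
  have hs' : T'.toSubring ≤ O.toSubring := by
    intro x hx
    have hx' : x ∈ T.map (e.symm : K →ₐ[A] K') := hT' ▸ hx
    obtain ⟨y, hy, rfl⟩ := Subalgebra.mem_map.mp hx'
    exact hs hy
  refine ⟨s.image e.symm, hs', ?_⟩
  -- the ring isomorphism `T ≃ T'` induced by `e.symm`
  let g₀ : T ≃ₐ[A] T.map (e.symm : K →ₐ[A] K') := e.symm.subalgebraMap T
  let g : T ≃+* T' := g₀.toRingEquiv.trans (RingEquiv.subsemiringCongr (by rw [hT'])).symm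
  have hg : ∀ x : T, ((g x : T') : K') = e.symm x := fun _ => rfl
  -- centres correspond
  set P : Ideal T := Ideal.comap (Subring.inclusion hs) (maximalIdeal OK) with hP
  set P' : Ideal T' := Ideal.comap (Subring.inclusion hs') (maximalIdeal O) with hP'
  have hPP' : P = P'.comap g.toRingHom := by
    ext x
    simp only [hP, hP', Ideal.mem_comap, RingEquiv.toRingHom_eq_coe, RingHom.coe_coe]
    rw [ValuationSubring.valuation_lt_one_iff, ValuationSubring.valuation_lt_one_iff]
    change OK.valuation (x : K) < 1 ↔ O.valuation ((g x : T') : K') < 1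
    rw [hg, valuation_comap_lt_one_iff, hf]
  haveI : P'.IsPrime := Ideal.IsPrime.comap _
  have hmap : Submonoid.map g.toRingHom.toMonoidHom P.primeCompl = P'.primeCompl := by
    ext y
    constructor
    · rintro ⟨x, hx, rfl⟩
      simpa [Ideal.primeCompl, hPP'] using hx
    · intro hy
      refine ⟨g.symm y, ?_, by simp⟩
      simpa [Ideal.primeCompl, hPP'] using hy
  exact IsRegularLocalRing.of_ringEquiv (R := Localization.AtPrime P)
    (IsLocalization.ringEquivOfRingEquiv (Localization.AtPrime P) (Localization.AtPrime P')
      g hmap)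

/-! ## Localising a sandwiched subring -/

/-- Membership in the localisation of a domain realised inside its fraction field
(`Localization.subalgebra.ofField`). [folklore] -/
theorem mem_ofField_iff {A : Type u} [CommRing A] {K : Type u} [Field K] [Algebra A K]
    [IsFractionRing A K] (S : Submonoid A) (hS : S ≤ nonZeroDivisors A) (x : K) :
    x ∈ Localization.subalgebra.ofField K S hS ↔
      ∃ (a s : A) (_ : s ∈ S), x = algebraMap A K a * (algebraMap A K s)⁻¹ :=
  Iff.rfl

/-- **Sandwich.** Let `A' ⊆ T` be subrings of a field `K` with `Frac A' = K`, `P` a prime of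
`T` and `P' = P ∩ A'`. If every `t ∈ T` satisfies `t · s' = a'` for some `a' ∈ A'`,
`s' ∈ A' ∖ P'`, then `T_P = A'_{P'}` inside `K`; in particular `T_P` is a regular local ring
if `A'_{P'}` is. [folklore] -/
theorem isRegularLocalRing_localization_of_sandwich {K : Type u} [Field K] {A' T : Subring K}
    (hle : A' ≤ T) [IsFractionRing A' K] (P : Ideal T) [P.IsPrime] (P' : Ideal A') [P'.IsPrime]
    (hP' : P.comap (Subring.inclusion hle) = P')
    (H : ∀ t : T, ∃ a s : A', Subring.inclusion hle s ∉ P ∧ (t : K) * s = a)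
    (hreg : IsRegularLocalRing (Localization.AtPrime P')) :
    IsRegularLocalRing (Localization.AtPrime P) := by
  classical
  subst hP'
  set P' : Ideal A' := P.comap (Subring.inclusion hle) with hP'def
  -- `Frac T = K`
  haveI : IsFractionRing T K := by
    refine IsFractionRing.of_field T K fun z => ?_
    obtain ⟨a, b, -, rfl⟩ := IsFractionRing.div_surjective (A := A') z
    exact ⟨⟨a, hle a.2⟩, ⟨b, hle b.2⟩, rfl⟩
  -- the two localisations inside `K`
  let R₁ : Subalgebra A' K :=
    Localization.subalgebra.ofField K P'.primeCompl P'.primeCompl_le_nonZeroDivisors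
  let R₂ : Subalgebra T K :=
    Localization.subalgebra.ofField K P.primeCompl P.primeCompl_le_nonZeroDivisors
  have h0P' : ∀ s : A', s ∉ P' → (s : K) ≠ 0 := fun s hs h0 =>
    hs (by rw [show s = 0 from Subtype.ext h0]; exact P'.zero_mem)
  have hR : R₁.toSubring = R₂.toSubring := by
    ext x
    change x ∈ R₁ ↔ x ∈ R₂
    rw [mem_ofField_iff, mem_ofField_iff]
    constructor
    · rintro ⟨a, s, hs, rfl⟩
      exact ⟨Subring.inclusion hle a, Subring.inclusion hle s, hs, rfl⟩
    · rintro ⟨t, u, hu, rfl⟩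
      obtain ⟨a₁, s₁, hs₁, h₁⟩ := H t
      obtain ⟨a₂, s₂, hs₂, h₂⟩ := H u
      have ha₂ : Subring.inclusion hle a₂ = u * Subring.inclusion hle s₂ :=
        Subtype.ext (by simpa using h₂.symm)
      have ha₂P : a₂ ∉ P' := by
        change Subring.inclusion hle a₂ ∉ P
        rw [ha₂]
        exact (Ideal.IsPrime.mul_notMem ‹P.IsPrime›) hu hs₂
      have hs₁P' : s₁ ∉ P' := hs₁
      refine ⟨a₁ * s₂, s₁ * a₂, ?_, ?_⟩
      · exact (Ideal.IsPrime.mul_notMem inferInstance) hs₁P' ha₂P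
      · have hs₁0 := h0P' s₁ hs₁P'
        have ha₂0 := h0P' a₂ ha₂P
        have hs₂0 := h0P' s₂ hs₂
        have hu0 : ((u : T) : K) ≠ 0 := by
          intro h; apply ha₂0
          have := h₂; rw [h, zero_mul] at this
          exact_mod_cast this.symm
        change ((t : T) : K) * (((u : T) : K))⁻¹ =
          ((a₁ * s₂ : A') : K) * (((s₁ * a₂ : A') : K))⁻¹
        push_cast
        rw [← h₁, ← h₂]
        field_simp
  -- assemble the isomorphisms
  haveI : IsLocalization.AtPrime R₁ P' :=
    Localization.subalgebra.isLocalization_ofField K P'.primeCompl _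
  haveI : IsLocalization.AtPrime R₂ P :=
    Localization.subalgebra.isLocalization_ofField K P.primeCompl _
  let e₁ : Localization.AtPrime P' ≃ₐ[A'] R₁ := IsLocalization.algEquiv P'.primeCompl _ _
  let e₂ : Localization.AtPrime P ≃ₐ[T] R₂ := IsLocalization.algEquiv P.primeCompl _ _
  let e : R₁ ≃+* R₂ := RingEquiv.subringCongr hR
  haveI : IsRegularLocalRing R₁ := IsRegularLocalRing.of_ringEquiv e₁.toRingEquiv
  haveI : IsRegularLocalRing R₂ := IsRegularLocalRing.of_ringEquiv e
  exact IsRegularLocalRing.of_ringEquiv e₂.toRingEquiv.symm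

/-! ## The bridge -/

/-- If `x, y` lie in a valuation ring and `x * y = 1` then `v(x) = 1`. [folklore] -/
theorem valuation_eq_one_of_mul_eq_one {K : Type u} [Field K] (O : ValuationSubring K)
    {x y : K} (hx : x ∈ O) (hy : y ∈ O) (hxy : x * y = 1) : O.valuation x = 1 := by
  have hx1 := (O.valuation_le_one_iff x).mpr hx
  have hy1 := (O.valuation_le_one_iff y).mpr hy
  refine le_antisymm hx1 ?_
  calc (1 : _) = O.valuation x * O.valuation y := by rw [← map_mul, hxy, map_one]
    _ ≤ O.valuation x * 1 := mul_le_mul_right hy1 _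
    _ = O.valuation x := mul_one _

/-- **Bridge** (`ArithmeticalThreefolds.lean`, Faithfulness notes): relative local
uniformization of affine models of dimension `≤ 3` over `k` implies Cossart–Piltant's (LU) for
every local ring `A_𝔭` of every affine model `A ⊆ K` (`A` finitely generated over `k`,
`Frac A = K`, `dim A ≤ 3`). [cite: CossartPiltant2019, §4.1 (LU)] -/
theorem LocalUniformization3.cpLocalUniformization {k : Type u} [Field k]
    (h : LocalUniformization3 k) {K : Type u} [Field K] [Algebra k K] (A : Subalgebra k K)
    (hfg : A.FG) (hfr : IsFractionRing A K) (hdim : ringKrullDim A ≤ 3)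
    (p : Ideal A) [p.IsPrime] :
    CPLocalUniformization (Localization.AtPrime p) := by
  classical
  haveI := hfr
  -- `A_𝔭 → K`
  have hunit : ∀ s : p.primeCompl, IsUnit (algebraMap A K s) := fun s => by
    rw [isUnit_iff_ne_zero]
    intro h0
    apply s.2
    have : (s : A) = 0 := (IsFractionRing.injective A K) (h0.trans (map_zero _).symm)
    rw [this]
    exact p.zero_mem
  letI : Algebra (Localization.AtPrime p) K :=
    (IsLocalization.lift (M := p.primeCompl) hunit).toAlgebra
  haveI : IsScalarTower A (Localization.AtPrime p) K :=
    IsScalarTower.of_algebraMap_eq fun a => (IsLocalization.lift_eq hunit a).symm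
  haveI : IsFractionRing (Localization.AtPrime p) K :=
    IsFractionRing.isFractionRing_of_isDomain_of_isLocalization p.primeCompl
      (Localization.AtPrime p) K
  refine cpLocalUniformization_of_fractionField (Localization.AtPrime p) K fun O hAO hdom => ?_
  have hAK : ∀ a : A, algebraMap (Localization.AtPrime p) K (algebraMap A _ a) = (a : K) :=
    fun a => (IsScalarTower.algebraMap_apply A (Localization.AtPrime p) K a).symm
  -- `A ⊆ O`
  have hAO' : A.toSubring ≤ O.toSubring := fun x hx => by
    have := hAO (algebraMap A (Localization.AtPrime p) ⟨x, hx⟩)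
    rwa [hAK] at this
  obtain ⟨A', hA'O, hAA', ⟨t, ht⟩, hreg⟩ := h K O A hAO' hfg hfr hdim
  -- `T := A_𝔭[t] ⊆ O`
  let T : Subalgebra (Localization.AtPrime p) K :=
    Algebra.adjoin (Localization.AtPrime p) (t : Set K)
  have htA' : (t : Set K) ⊆ A' := fun x hx => ht ▸ Algebra.subset_adjoin hx
  have hTO : T.toSubring ≤ O.toSubring := by
    intro x hx
    refine Algebra.adjoin_induction (p := fun x _ => x ∈ O) ?_ ?_ ?_ ?_
      (show x ∈ T from hx)
    · exact fun x hx => hA'O (htA' hx)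
    · exact fun r => hAO r
    · exact fun _ _ _ _ hx hy => add_mem hx hy
    · exact fun _ _ _ _ hx hy => mul_mem hx hy
  refine ⟨t, hTO, ?_⟩
  -- `A' ⊆ T`
  have hle : A'.toSubring ≤ T.toSubring := by
    intro x hx
    have hx' : x ∈ Algebra.adjoin k (t : Set K) := ht ▸ (show x ∈ A' from hx)
    refine Algebra.adjoin_induction (p := fun x _ => x ∈ T) ?_ ?_ ?_ ?_ hx'
    · exact fun x hx => Algebra.subset_adjoin hx
    · intro c
      have h1 : algebraMap k K c = ((algebraMap k A c : A) : K) := rfl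
      rw [h1, ← hAK]
      exact T.algebraMap_mem _
    · exact fun _ _ _ _ hx hy => add_mem hx hy
    · exact fun _ _ _ _ hx hy => mul_mem hx hy
  -- every element of `T` is `a'/s'`
  set P : Ideal T.toSubring := Ideal.comap (Subring.inclusion hTO) (maximalIdeal O) with hPdef
  have hQ : ∀ x ∈ T, ∃ a s : K, a ∈ A' ∧ s ∈ A' ∧ O.valuation s = 1 ∧ x * s = a := by
    intro x hx
    refine Algebra.adjoin_induction (p := fun x _ => ∃ a s : K, a ∈ A' ∧ s ∈ A' ∧
      O.valuation s = 1 ∧ x * s = a) ?_ ?_ ?_ ?_ hx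
    · intro x hx
      exact ⟨x, 1, htA' hx, one_mem _, map_one _, mul_one _⟩
    · intro r
      obtain ⟨a, s, rfl⟩ := IsLocalization.exists_mk'_eq p.primeCompl r
      refine ⟨(a : K), ((s : A) : K), hAA' a.2, hAA' (s : A).2, ?_, ?_⟩
      · obtain ⟨u, hu⟩ := IsLocalization.map_units (Localization.AtPrime p) s
        refine valuation_eq_one_of_mul_eq_one O
          (y := algebraMap _ K (↑u⁻¹ : Localization.AtPrime p))
          (by rw [← hAK]; exact hAO _) (hAO _) ?_
        rw [← hAK, ← hu, ← map_mul, Units.mul_inv, map_one]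
      · rw [← hAK (s : A), ← hAK a, ← map_mul, IsLocalization.mk'_spec]
    · rintro x y - - ⟨a₁, s₁, ha₁, hs₁, hv₁, h₁⟩ ⟨a₂, s₂, ha₂, hs₂, hv₂, h₂⟩
      refine ⟨a₁ * s₂ + a₂ * s₁, s₁ * s₂, add_mem (mul_mem ha₁ hs₂) (mul_mem ha₂ hs₁),
        mul_mem hs₁ hs₂, by rw [map_mul, hv₁, hv₂, mul_one], ?_⟩
      rw [← h₁, ← h₂]; ring
    · rintro x y - - ⟨a₁, s₁, ha₁, hs₁, hv₁, h₁⟩ ⟨a₂, s₂, ha₂, hs₂, hv₂, h₂⟩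
      refine ⟨a₁ * a₂, s₁ * s₂, mul_mem ha₁ ha₂, mul_mem hs₁ hs₂,
        by rw [map_mul, hv₁, hv₂, mul_one], ?_⟩
      rw [← h₁, ← h₂]; ring
  have H : ∀ x : T.toSubring, ∃ a s : A'.toSubring,
      Subring.inclusion hle s ∉ P ∧ (x : K) * s = a := by
    intro x
    obtain ⟨a, s, ha, hs, hv, hxs⟩ := hQ x x.2
    refine ⟨⟨a, ha⟩, ⟨s, hs⟩, ?_, hxs⟩
    rw [hPdef, Ideal.mem_comap, ValuationSubring.valuation_lt_one_iff]
    change ¬ O.valuation s < 1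
    rw [hv]
    exact lt_irrefl 1
  haveI : IsFractionRing A'.toSubring K := isFractionRing_of_le hAA' hfr
  haveI : (centreIdeal A' O hA'O).IsPrime := by unfold centreIdeal; infer_instance
  refine isRegularLocalRing_localization_of_sandwich hle P (centreIdeal A' O hA'O) ?_ H hreg
  rw [hPdef, Ideal.comap_comap]
  rfl

/-- Under `CossartPiltant2019LU3`, every local ring of every affine model of dimension `≤ 3`
over any field has Cossart–Piltant's property (LU) — for all dominating valuations.
[cite: CossartPiltant2019, Thm. 1.1 with §4.1 (LU)] -/
theorem CossartPiltant2019LU3.cpLocalUniformization (h : CossartPiltant2019LU3.{u})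
    {k K : Type u} [Field k] [Field K] [Algebra k K] (A : Subalgebra k K) (hfg : A.FG)
    (hfr : IsFractionRing A K) (hdim : ringKrullDim A ≤ 3) (p : Ideal A) [p.IsPrime] :
    CPLocalUniformization (Localization.AtPrime p) :=
  (h k).cpLocalUniformization A hfg hfr hdim p

end Literature.AlgebraicGeometry.Resolution

end
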